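import Literature.MathematicalPhysics.QuantumFieldTheory.Balaban1983to89.T4RemnantBooking

/-!
# `Balaban1983to89.T4MatchingClosureRem` — the node-U5 closure WITH THE REMNANT CLAUSE AS A NAMED BINDER (cell
`pub-balaban`, T4-DAG v7 §5 rows T4-U5.E-CLOSE / T4-U5.E-b-R1 / T4-U5.E-REM°, §8 Q20; referee report
`t4/T4-REF-U5.md` v1 §0 (0.2), (0.5), §2 F2; records `t4/T4-EST-U5.md` v1.4 §0 (j), `t4/T4-EST-U5E-b-R1.md`)

HONEST FRAMING (cell `pub-balaban`, T4-DAG PAGE 1).  The cell's T4 target is the existence AND uniqueness of the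
continuum limit of Bałaban's unit-scale averaged loop expectations on a finite torus — strictly beyond ultraviolet
stability ([Balaban1989LargeFieldII] Thm 1 p. 355); it is NOT the Yang–Mills mass gap and NOT the Clay problem.  This
module is KERNEL BOOKKEEPING ONLY: it re-states the end-to-end closure theorems of `T4MatchingClosure` §9
(`hybridNE7_closure_tail`, `stringHybridNE7_closure`) with the cell's located remnant estimate NE7b-rem VISIBLE as the
named hypothesis `(hRem : T4RemnantBooking.RemnantAgeBound remOld E₀ ρ)` (typed by unit `b2b-balaban-pv16` gen 6,
p181634), as ruled by the carver (T4-DAG v7 ruling on row U5.E-CLOSE, referee (0.5): "expose a NAMED binder for the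
remnant clause") and as agreed in §8 Q20 (packaging (REM) primary, (BAD′) the alternative).  It lives in its own leaf
because `T4RemnantBooking` imports `T4MatchingClosure` (an in-place section would be an import cycle).

WHAT THE BINDER DOES HERE, EXACTLY (no over-claim).  Under the (REM) packaging the two-run discrepancy of the remnant
families met at the recent steps `j ∈ [jlog_C(K), K]` is booked in the good-class core's RATES: the OLD-BORN part (age
`≥ A(K) = ⌈C′·log(K+1)⌉` epochs; per scale-`j` cube `remOld j A ≤ E₀·ρ^A` = `RemnantAgeBound`, NOT PRINTED — print's
[Balaban1989LargeFieldII] (1.92) p. 388 / (1.100) p. 390 are the age-free case `A = 0`; these page numbers are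
LOCATIONS, nothing is quoted) contributes `remnantOld remOld Λ C C′ K = Σ_{j ∈ [jlog_C K, K]} Λ^{K−j}·remOld j (A(K))`
to the UV-radius rate `u` (field `ReindexedBudget.uv_radius`), and the YOUNG part (a rate `θ^{j − N′A(K)}` degraded by
the age allowance) contributes `C_y·remnantYoung θ Λ C C′ N′ K` to the recent-remainder rate `r` (field
`ReindexedBudget.recent_remainder`).  At closure level the binder `hRem` is therefore load-bearing ONLY through the two
summabilities `Summable u`, `Summable r` of `T4MatchingClosure.hybridNE7_closure_tail`, which this module DISCHARGES
from `Summable u′`, `Summable r′` of the remaining rates by `T4RemnantBooking.summable_remnantOld_logWindow` /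
`summable_remnantYoung_logWindow`; the ANALYTIC content — that the producers' per-term bounds `Rr ≤ RrRec + vol·u K`,
`RrRec ≤ vol·r K` hold with these rates for Bałaban's procedure — is inside the binder
`hTB : ReindexedBudget … (u′ + remnantOld) … (r′ + C_y·remnantYoung) …` and is the producers' obligation (rows
T4-U5.E-b / E-b-R1 / E-REM°, units pv16 / pv25), NOT proved anywhere in the tree.  CONDITIONS recorded as binders:
`1 ≤ Λ`, `0 ≤ C′`, `0 ≤ E₀`, `0 < ρ < 1`, `⌈C·log Λ⌉₊ + 3 ≤ C′·(−log ρ)` (old-born), `0 < θ < 1` (young; no condition);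
`0 ≤ C` is derived from the weight half's `1 < C·(−log r₀)` — the log window of the weight cut and of the remnant
booking is ONE window (`jlogOf C`).

ABSOLUTE RULE.  Nothing of [Balaban1989LargeFieldII] is asserted; no `[cite:]` tag; page numbers are LOCATIONS.  Every
declaration is [folklore] bookkeeping over `T4MatchingClosure` §4/§9 and `T4RemnantBooking` §2–§4.  Rung-(B)+1 value =
the user-facing binder list of node U5 with NE7b-rem named; NOT an estimate, NOT summit progress.  Unit
`b2b-balaban-pv02` gen 7 (journal CLAIM T4-U5.E-CLOSE*-REM 2026-08-19T00:39:34Z; v1 p181697; v1.1 = DOCFIX-lite: guillemets reserved for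
verbatim print, cell convention — kernel content unchanged).  v1.2 (gen 8, journal CLAIM T4-U5.E-CLOSE*-REMW
2026-08-19T01:00:01Z) = §5–§8 APPENDED, §1–§4 unchanged: the young allowance made ABSTRACT — any sub-linear window
`W(K) = o(K)` (`SublinearWindow`, `remnantYoungW`, `hybridNE7_closure_remnantW`, `stringHybridNE7_closure_remnantW`),
every polylogarithmic window being one (`PolylogWindow.sublinear`) — answering record `t4/T4-EST-U5E-rem.md` v1 (unit
`b2b-balaban-pv25` gen 5) §4 Lemma Y / §7 (2): under the bank-age convention the young allowance is `A(K)·N′_K` steps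
with `N′_K` polylogarithmic in `K`, not `N′·A(K)` with `N′` fixed; the closure is convention-neutral.
-/

open Finset _root_.Filter _root_.Topology

namespace Literature.MathematicalPhysics.QuantumFieldTheory.Balaban1983to89.T4MatchingClosureRem

open T4CauchySum T4GoodClassBudget T4HistoryPeeling T4MatchingAssembly T4MatchingClosure T4RemnantBooking

/-! ## §1 The two remnant rates -/

section Rates

/-- The OLD-BORN remnant rate on the log window: `Σ_{j ∈ [jlog_C K, K]} Λ^{K−j}·remOld j (A(K))`,
`A(K) = ageCut C′ K`. [folklore] (a definition) -/
noncomputable def remnantOld (remOld : ℕ → ℕ → ℝ) (Λ C C' : ℝ) (K : ℕ) : ℝ :=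
  ∑ j ∈ Icc (jlogOf C K) K, Λ ^ (K - j) * remOld j (ageCut C' K)

/-- The YOUNG remnant rate on the log window: `θ^{−N′A(K)}·windowSum θ Λ (jlog_C K) K`. [folklore] (a definition) -/
noncomputable def remnantYoung (θ Λ C C' : ℝ) (N' : ℕ) (K : ℕ) : ℝ :=
  θ⁻¹ ^ (N' * ageCut C' K) * windowSum θ Λ (jlogOf C K) K

/-- `0 ≤ C` from the weight half's window condition `1 < C·(−log r₀)` (`0 < r₀ < 1`). [folklore] -/
theorem logCutConst_nonneg {r₀ C : ℝ} (h0 : 0 < r₀) (h1 : r₀ < 1) (hC : 1 < C * (-Real.log r₀)) : 0 ≤ C := by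
  have hl : 0 < -Real.log r₀ := by have := Real.log_neg h0 h1; linarith
  rcases le_or_gt 0 C with hC0 | hneg
  · exact hC0
  · have : C * (-Real.log r₀) < 0 := mul_neg_of_neg_of_pos hneg hl
    linarith

/-- The UV-radius rate WITH the old-born remnant part is summable (`T4RemnantBooking.summable_remnantOld_logWindow`).
[folklore] -/
theorem summable_add_remnantOld {Λ C C' E₀ ρ : ℝ} {remOld : ℕ → ℕ → ℝ} {u' : ℕ → ℝ} (hu : Summable u')
    (hΛ : 1 ≤ Λ) (hC : 0 ≤ C) (hE : 0 ≤ E₀) (hρ0 : 0 < ρ) (hρ1 : ρ < 1) (hRem : RemnantAgeBound remOld E₀ ρ)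
    (hq : ((⌈C * Real.log Λ⌉₊ : ℕ) : ℝ) + 3 ≤ C' * (-Real.log ρ)) :
    Summable fun K => u' K + remnantOld remOld Λ C C' K :=
  hu.add (summable_remnantOld_logWindow hΛ hC hE hρ0 hρ1 hRem hq)

/-- The recent-remainder rate WITH the young remnant part is summable
(`T4RemnantBooking.summable_remnantYoung_logWindow`; no condition on `θ < 1`). [folklore] -/
theorem summable_add_remnantYoung {θ Λ C C' Cy : ℝ} {N' : ℕ} {r' : ℕ → ℝ} (hr : Summable r') (hθ : 0 < θ)
    (hθ1 : θ < 1) (hΛ : 1 ≤ Λ) (hC : 0 ≤ C) (hC' : 0 ≤ C') :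
    Summable fun K => r' K + Cy * remnantYoung θ Λ C C' N' K :=
  hr.add ((summable_remnantYoung_logWindow N' hθ hθ1 hΛ hC hC').mul_left Cy)

end Rates

/-! ## §2 The closure with the remnant clause as a named binder -/

section Closure

variable {ι : Type*} [DecidableEq ι] {l₀ vol : ℝ} {T : ℕ → Finset ι} {A B Acore Bcore : ℕ → ℝ → ι → ℝ}
  {Bad : ℕ → ℝ → Finset ι} {Cc Rr CcRec RrRec : ℕ → ℝ → ι → ℝ} {ν u' s₂ c₀ r' s L : ℕ → ℝ}
  {remOld : ℕ → ℕ → ℝ} {Λ C' E₀ ρ θ Cy : ℝ} {N' : ℕ}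

/-- **THE NODE-U5 CLOSURE WITH NE7b-rem NAMED** (`T4MatchingClosure.hybridNE7_closure_tail` + the remnant booking):
the binders are those of `hybridNE7_closure_tail` with the UV-radius rate `u := u′ + remnantOld remOld Λ C C′` and the
recent-remainder rate `r := r′ + C_y·remnantYoung θ Λ C C′ N′` inside `ReindexedBudget`, the summabilities of `u′`,
`r′` in place of those of `u`, `r`, AND the named remnant hypothesis `hRem : RemnantAgeBound remOld E₀ ρ` with its
constants.  Conclusion: `∃ K₀`, a `HybridNE7` datum for the `K₀`-shifted families.  CONDITIONAL on the located new
estimates NE7b (`hDA`/`hDB`), NE7c (flattened bounds), NE7 good-class half + NE-R1 two-run half + NE7b-rem's per-term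
use (`hTB`), NE7b-rem's shape (`hRem`) — none PRINTED, none proved here. [folklore] -/
theorem hybridNE7_closure_remnant {r₀ V C : ℝ} (h0 : 0 < r₀) (h1 : r₀ < 1) (hV : 0 ≤ V) (hC : 1 < C * (-Real.log r₀))
    (hA : ∀ K t, |t| ≤ l₀ → ∀ τ ∈ T K, 0 ≤ A K t τ) (hB : ∀ K t, |t| ≤ l₀ → ∀ τ ∈ T K, 0 ≤ B K t τ)
    (hDA : SlotDom l₀ T A Bad fun K => V * r₀ ^ (K - jlogOf C K))
    (hDB : SlotDom l₀ T B Bad fun K => V * r₀ ^ (K - jlogOf C K))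
    (hL0 : ∀ K, 0 ≤ L K) (hLs : Summable L)
    (hA0 : ∀ K t, |t| ≤ l₀ → ∀ τ ∈ T K, 0 ≤ Acore K t τ)
    (hAlo : ∀ K t, |t| ≤ l₀ → ∀ τ ∈ T K, Acore K t τ ≤ A K t τ)
    (hAhi : ∀ K t, |t| ≤ l₀ → ∀ τ ∈ T K, A K t τ ≤ Real.exp (L K) * Acore K t τ)
    (hB0 : ∀ K t, |t| ≤ l₀ → ∀ τ ∈ T K, 0 ≤ Bcore K t τ)
    (hBlo : ∀ K t, |t| ≤ l₀ → ∀ τ ∈ T K, Bcore K t τ ≤ B K t τ)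
    (hBhi : ∀ K t, |t| ≤ l₀ → ∀ τ ∈ T K, B K t τ ≤ Real.exp (L K) * Bcore K t τ)
    (hRem : RemnantAgeBound remOld E₀ ρ) (hΛ : 1 ≤ Λ) (hC' : 0 ≤ C') (hE : 0 ≤ E₀) (hρ0 : 0 < ρ) (hρ1 : ρ < 1)
    (hq : ((⌈C * Real.log Λ⌉₊ : ℕ) : ℝ) + 3 ≤ C' * (-Real.log ρ)) (hθ : 0 < θ) (hθ1 : θ < 1)
    (hTB : ReindexedBudget l₀ vol T Acore Bcore Bad Cc Rr CcRec RrRec ν (fun K => u' K + remnantOld remOld Λ C C' K) s₂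
      c₀ (fun K => r' K + Cy * remnantYoung θ Λ C C' N' K) s)
    (hr : Summable r') (hu : Summable u') (hs : Summable s) (hs₂ : Summable s₂) :
    ∃ K₀, HybridNE7 l₀ vol (fun K => T (K₀ + K)) (fun K => A (K₀ + K)) (fun K => B (K₀ + K)) (fun K => Bad (K₀ + K))
      (fun K => 1 - Real.exp (-(V * r₀ ^ (K₀ + K - jlogOf C (K₀ + K)))))
      (fun K t τ => A (K₀ + K) t τ - Acore (K₀ + K) t τ) (fun K t τ => B (K₀ + K) t τ - Bcore (K₀ + K) t τ)
      (fun K => 1 - Real.exp (-L (K₀ + K)))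
      (fun K => ((r' (K₀ + K) + Cy * remnantYoung θ Λ C C' N' (K₀ + K)) +
          (u' (K₀ + K) + remnantOld remOld Λ C C' (K₀ + K))) + (s (K₀ + K) + s₂ (K₀ + K))) :=
  have hC0 : 0 ≤ C := logCutConst_nonneg h0 h1 hC
  hybridNE7_closure_tail h0 h1 hV hC hA hB hDA hDB hL0 hLs hA0 hAlo hAhi hB0 hBlo hBhi hTB
    (summable_add_remnantYoung hr hθ hθ1 hΛ hC0 hC') (summable_add_remnantOld hu hΛ hC0 hE hρ0 hρ1 hRem hq) hs hs₂

end Closure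

/-! ## §3 Per string, end to end, with the remnant clause named -/

section Scheme

open Missing T4Continuum T4Assembly

variable {G : Type*} [GaugeGroup G] [MeasurableSpace G] [HaarData G] {O : Type*}

/-- **PER STRING, END TO END, NE7b-rem NAMED** (`T4MatchingClosure.stringHybridNE7_closure` + the remnant booking):
closure hypotheses with `u := u′ + remnantOld …`, `r := r′ + C_y·remnantYoung …`, the named binder
`hRem : RemnantAgeBound remOld E₀ ρ` with its constants, and the E1/E2 dictionary from `K₀` steps on give
`∃ K₁, StringHybridNE7 S os l₀ vol (K₀ + K₁)` — the per-string hypothesis of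
`T4MatchingAssembly.genFunCauchy_of_hybridNE7` / `hasContinuumLimit_of_hybridNE7`.  USER-FACING BINDER LIST OF NODE U5
(this theorem's hypotheses): constants `r₀ V C` (`0 < r₀ < 1`, `0 ≤ V`, `1 < C·(−log r₀)`); non-negativity of the two
runs' terms; `SlotDom` ×2 under the log cut (NE7b; same `T`, `Bad`); flattened bounds with summable `L` (NE7c);
`RemnantAgeBound` with `1 ≤ Λ`, `0 ≤ C′`, `0 ≤ E₀`, `0 < ρ < 1`, `⌈C log Λ⌉₊ + 3 ≤ C′(−log ρ)`, `0 < θ < 1` (NE7b-rem,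
shape + window arithmetic); `ReindexedBudget` on the cores with the remnant rates inside `u`, `r` (NE7 good-class half
on I-2′ + NE-R1 two-run half + NE7b-rem's per-term use); `Summable r′ u′ s s₂` (U4′ through the producers); the
dictionary `hZA`/`hZB` (E1/E2).  Nothing else. [folklore] -/
theorem stringHybridNE7_closure_remnant (S : TorusScheme G O) (os : List O) (K₀ : ℕ) {ι : Type} [DecidableEq ι]
    {l₀ vol : ℝ} {T : ℕ → Finset ι} {A B Acore Bcore : ℕ → ℝ → ι → ℝ} {Bad : ℕ → ℝ → Finset ι}
    {Cc Rr CcRec RrRec : ℕ → ℝ → ι → ℝ} {ν u' s₂ c₀ r' s L : ℕ → ℝ} {remOld : ℕ → ℕ → ℝ} {Λ C' E₀ ρ θ Cy : ℝ}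
    {N' : ℕ} {r₀ V C : ℝ}
    (h0 : 0 < r₀) (h1 : r₀ < 1) (hV : 0 ≤ V) (hC : 1 < C * (-Real.log r₀))
    (hA : ∀ K t, |t| ≤ l₀ → ∀ τ ∈ T K, 0 ≤ A K t τ) (hB : ∀ K t, |t| ≤ l₀ → ∀ τ ∈ T K, 0 ≤ B K t τ)
    (hDA : SlotDom l₀ T A Bad fun K => V * r₀ ^ (K - jlogOf C K))
    (hDB : SlotDom l₀ T B Bad fun K => V * r₀ ^ (K - jlogOf C K))
    (hL0 : ∀ K, 0 ≤ L K) (hLs : Summable L)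
    (hA0 : ∀ K t, |t| ≤ l₀ → ∀ τ ∈ T K, 0 ≤ Acore K t τ)
    (hAlo : ∀ K t, |t| ≤ l₀ → ∀ τ ∈ T K, Acore K t τ ≤ A K t τ)
    (hAhi : ∀ K t, |t| ≤ l₀ → ∀ τ ∈ T K, A K t τ ≤ Real.exp (L K) * Acore K t τ)
    (hB0 : ∀ K t, |t| ≤ l₀ → ∀ τ ∈ T K, 0 ≤ Bcore K t τ)
    (hBlo : ∀ K t, |t| ≤ l₀ → ∀ τ ∈ T K, Bcore K t τ ≤ B K t τ)
    (hBhi : ∀ K t, |t| ≤ l₀ → ∀ τ ∈ T K, B K t τ ≤ Real.exp (L K) * Bcore K t τ)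
    (hRem : RemnantAgeBound remOld E₀ ρ) (hΛ : 1 ≤ Λ) (hC' : 0 ≤ C') (hE : 0 ≤ E₀) (hρ0 : 0 < ρ) (hρ1 : ρ < 1)
    (hq : ((⌈C * Real.log Λ⌉₊ : ℕ) : ℝ) + 3 ≤ C' * (-Real.log ρ)) (hθ : 0 < θ) (hθ1 : θ < 1)
    (hTB : ReindexedBudget l₀ vol T Acore Bcore Bad Cc Rr CcRec RrRec ν (fun K => u' K + remnantOld remOld Λ C C' K) s₂
      c₀ (fun K => r' K + Cy * remnantYoung θ Λ C C' N' K) s)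
    (hr : Summable r') (hu : Summable u') (hs : Summable s) (hs₂ : Summable s₂)
    (hZA : ∀ K t, |t| ≤ l₀ → T4GenFunBounds.schemeZ S os (K₀ + K) t = ∑ τ ∈ T K, A K t τ)
    (hZB : ∀ K t, |t| ≤ l₀ → T4GenFunBounds.schemeZ S os (K₀ + K + 1) t = ∑ τ ∈ T K, B K t τ) :
    ∃ K₁, StringHybridNE7 S os l₀ vol (K₀ + K₁) :=
  have hC0 : 0 ≤ C := logCutConst_nonneg h0 h1 hC
  stringHybridNE7_closure S os K₀ h0 h1 hV hC hA hB hDA hDB hL0 hLs hA0 hAlo hAhi hB0 hBlo hBhi hTB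
    (summable_add_remnantYoung hr hθ hθ1 hΛ hC0 hC') (summable_add_remnantOld hu hΛ hC0 hE hρ0 hρ1 hRem hq) hs hs₂
    hZA hZB

end Scheme

/-! ## §4 Sanity: the remnant-rate hypotheses are jointly satisfiable -/

section Sanity

/-- SANITY (non-vacuity of the added binders): with the saturating profile `remOld j A := E₀·ρ^A`
(`T4RemnantBooking.remnantAgeBound_saturated`) and the age-cut constant of `T4RemnantBooking.exists_ageCutConst`,
the hypotheses `hRem`, `hq` of `hybridNE7_closure_remnant` hold together for any `0 ≤ E₀`, `0 < ρ < 1`, `C`, `Λ`.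
[folklore] -/
theorem remnantBinders_satisfiable {E₀ ρ : ℝ} (hE : 0 ≤ E₀) (hρ0 : 0 < ρ) (hρ1 : ρ < 1) (C Λ : ℝ) :
    ∃ C' : ℝ, 0 ≤ C' ∧ RemnantAgeBound (fun _ A => E₀ * ρ ^ A) E₀ ρ ∧
      ((⌈C * Real.log Λ⌉₊ : ℕ) : ℝ) + 3 ≤ C' * (-Real.log ρ) := by
  obtain ⟨C', hC', hq⟩ := exists_ageCutConst hρ0 hρ1 C Λ
  exact ⟨C', hC', remnantAgeBound_saturated hE hρ0.le, hq⟩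

end Sanity

/-! ## §5 Young remnants with a K-DEPENDENT allowance: any SUB-LINEAR window (v1.2, append-only)

Record `t4/T4-EST-U5E-rem.md` v1 (unit `b2b-balaban-pv25` gen 5, row T4-U5.E-REM°) §0 (c) / §4 Lemma Y (Y1)–(Y3) /
§7 (2) locate a CONVENTION point in the (REM) packaging and address it to this module: the notion of "age `≥ A`" that
makes BOTH halves true is the BANK age (the combinatorial bank `b(h)` of a sub-history; the record's suggested reading,
journal NOTE 2026-08-19T01:02:04Z: `A` = the number of banked units `c_e·p̄₀` of printed slack — births (1.81), renewals
p. 386, mergers (1.88) of [Balaban1989LargeFieldII]; event-free steps bank nothing, (1.83) — LOCATIONS only, nothing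
quoted, and `T4RemnantBooking`'s docstring is that module's one-writer's to word), under which the OLD half is
`RemnantAgeBound` as typed (read with bank-age) and the YOUNG half — a small-bank sub-history is RECENTLY CREATED — holds
with a `K`-DEPENDENT allowance `W(K) = A(K)·N′_K(A(K))` steps, the epoch length `N′_K` growing like a power of
`log(K+1)` (through the printed flow inequality (2.9) of [Balaban1988Convergent] p. 256 — a LOCATION, nothing quoted
here), i.e. `W(K) = O((log(K+2))^{r₀+1})`, instead of v1's `N′·A(K)` with a FIXED `N′`
(`T4RemnantBooking.summable_remnantYoung_logWindow`, `remnantYoung` above).  Lemma Y is cell analysis, NOT PRINTED and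
NOT proved here.  What IS kernel-checked below is that the closure does not care: the young rate
`remnantYoungW θ Λ C W K = θ^{−W(K)}·windowSum θ Λ (jlog_C K) K` is summable in `K` for EVERY allowance `W` that is
SUB-LINEAR, `W(K) = o(K)` (`SublinearWindow`), and every `0 < θ < 1`, because the log-window θ-sum is `poly(K)·θ^K`
(`T4MatchingClosure.windowSum_log_le`) and `θ^{−W(K)}·θ^K ≤ (θ^{1−η})^K` as soon as `W(K) ≤ ηK`, `η < 1`; §6 shows that
every POLYLOGARITHMIC allowance is sub-linear (Mathlib's `Real.isLittleO_pow_log_id_atTop`), the class being closed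
under products — so v1's `N′·ageCut C′` (exponent 1), the record's `ageCut C′ K·N′_K` with `N′_K ≤ ⌈a·log(K+2)^p + b⌉`
(exponent `p+1`), and an age cut with exponent `1+η` on the young side only are all instances.  The kernel statement is
CONVENTION-NEUTRAL: it does not decide between epoch / step / bank age; it records that the record's repair costs
nothing at closure level.  PLACEMENT (XREAD C-pv24g4-2, remark R1): `T4RemnantBooking` does not prescribe which
`ReindexedBudget` rate receives which half; old-born → `uv_radius` (`u`), young → `recent_remainder` (`r`) is THIS
module's assignment (old-born = a gain with no two-run rate, like a UV radius; young = a genuine recent rate) and is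
immaterial at closure level, where `termBudget_of_reindexed` merges `r K + u K`. [folklore arithmetic]
-/

section YoungW

open Asymptotics

/-- The YOUNG remnant rate with an ABSTRACT allowance `W : ℕ → ℕ` (steps): `θ^{−W(K)}·windowSum θ Λ (jlog_C K) K`
(record (Y3)'s suggested shape). [folklore] (a definition) -/
noncomputable def remnantYoungW (θ Λ C : ℝ) (W : ℕ → ℕ) (K : ℕ) : ℝ :=
  θ⁻¹ ^ W K * windowSum θ Λ (jlogOf C K) K

/-- v1's young rate is the instance `W K = N′·ageCut C′ K`. [folklore] -/
theorem remnantYoung_eq_remnantYoungW (θ Λ C C' : ℝ) (N' : ℕ) :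
    remnantYoung θ Λ C C' N' = remnantYoungW θ Λ C fun K => N' * ageCut C' K := rfl

/-- `0 ≤ remnantYoungW` for `0 ≤ θ`, `0 ≤ Λ`. [folklore] -/
theorem remnantYoungW_nonneg {θ Λ : ℝ} (hθ : 0 ≤ θ) (hΛ : 0 ≤ Λ) (C : ℝ) (W : ℕ → ℕ) (K : ℕ) :
    0 ≤ remnantYoungW θ Λ C W K :=
  mul_nonneg (pow_nonneg (inv_nonneg.2 hθ) _) (windowSum_nonneg hθ hΛ _ _)

/-- THE CORE INEQUALITY: an allowance of at most `ηK` steps eats at most the fraction `η` of the rate —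
`θ^{−w}·θ^K ≤ (θ^{1−η})^K` for `0 < θ ≤ 1`, `w ≤ ηK`. [folklore] -/
theorem inv_pow_mul_pow_le_rpow {θ η : ℝ} (hθ : 0 < θ) (hθ1 : θ ≤ 1) {w K : ℕ} (hw : (w : ℝ) ≤ η * K) :
    θ⁻¹ ^ w * θ ^ K ≤ (θ ^ (1 - η)) ^ K := by
  have h1 : θ⁻¹ ^ w * θ ^ K = θ ^ ((K : ℝ) - (w : ℝ)) := by
    rw [Real.rpow_sub hθ, Real.rpow_natCast, Real.rpow_natCast, inv_pow, div_eq_mul_inv, mul_comm]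
  have h2 : (1 - η) * (K : ℝ) ≤ (K : ℝ) - (w : ℝ) := by
    have e : (1 - η) * (K : ℝ) = K - η * K := by ring
    rw [e]; linarith
  rw [h1]
  calc θ ^ ((K : ℝ) - (w : ℝ)) ≤ θ ^ ((1 - η) * (K : ℝ)) := Real.rpow_le_rpow_of_exponent_ge hθ hθ1 h2
    _ = (θ ^ (1 - η)) ^ K := by rw [Real.rpow_mul hθ.le, Real.rpow_natCast]

/-- **ANY EVENTUALLY-`ηK` ALLOWANCE (`η < 1`) KEEPS THE YOUNG BUDGET SUMMABLE**: with `W K ≤ ηK` for all large `K`,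
`Σ_K θ^{−W(K)}·windowSum θ Λ (jlog_C K) K < ∞` for every `0 < θ < 1 ≤ Λ`, `C ≥ 0` — the window sum is
`≤ (C+2)θ⁻¹Λ·(K+1)^{N+1}·θ^K` (`windowSum_log_le`) and `θ^{−W(K)}θ^K ≤ (θ^{1−η})^K` (`inv_pow_mul_pow_le_rpow`), a
polynomial times a geometric sequence of ratio `θ^{1−η} < 1`; finitely many early `K` are irrelevant
(`Summable.of_norm_bounded_eventually_nat`). [folklore] -/
theorem summable_invPow_mul_windowSum_of_eventually {θ Λ C η : ℝ} {W : ℕ → ℕ} (hθ : 0 < θ) (hθ1 : θ < 1)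
    (hΛ : 1 ≤ Λ) (hC : 0 ≤ C) (hη : η < 1) (hW : ∀ᶠ K in atTop, (W K : ℝ) ≤ η * K) :
    Summable (fun K => θ⁻¹ ^ W K * windowSum θ Λ (jlogOf C K) K) := by
  have hΛ0 : 0 < Λ := lt_of_lt_of_le one_pos hΛ
  have hι0 : 0 ≤ θ⁻¹ := (inv_pos.2 hθ).le
  have hq0 : 0 ≤ θ ^ (1 - η) := Real.rpow_nonneg hθ.le _
  have hq1 : θ ^ (1 - η) < 1 := Real.rpow_lt_one hθ.le hθ1 (by linarith)
  have hA0 : 0 ≤ (C + 2) * (θ⁻¹ * Λ) := by positivity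
  have hmaj : Summable (fun K : ℕ => (C + 2) * (θ⁻¹ * Λ) *
      (((K : ℝ) + 1) ^ (⌈C * Real.log θ⁻¹ + C * Real.log Λ⌉₊ + 1) * (θ ^ (1 - η)) ^ K)) :=
    (summable_succ_pow_mul_geometric hq0 hq1 _).mul_left _
  refine Summable.of_norm_bounded_eventually_nat hmaj (hW.mono fun K hK => ?_)
  rw [Real.norm_of_nonneg (mul_nonneg (pow_nonneg hι0 _) (windowSum_nonneg hθ.le hΛ0.le _ _))]
  calc θ⁻¹ ^ W K * windowSum θ Λ (jlogOf C K) K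
      ≤ θ⁻¹ ^ W K * ((C + 2) * (θ⁻¹ * Λ) *
          (((K : ℝ) + 1) ^ (⌈C * Real.log θ⁻¹ + C * Real.log Λ⌉₊ + 1) * θ ^ K)) :=
        mul_le_mul_of_nonneg_left (windowSum_log_le hθ hθ1 hΛ hC K) (pow_nonneg hι0 _)
    _ = (C + 2) * (θ⁻¹ * Λ) *
          (((K : ℝ) + 1) ^ (⌈C * Real.log θ⁻¹ + C * Real.log Λ⌉₊ + 1) * (θ⁻¹ ^ W K * θ ^ K)) := by ring
    _ ≤ (C + 2) * (θ⁻¹ * Λ) *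
          (((K : ℝ) + 1) ^ (⌈C * Real.log θ⁻¹ + C * Real.log Λ⌉₊ + 1) * (θ ^ (1 - η)) ^ K) :=
        mul_le_mul_of_nonneg_left (mul_le_mul_of_nonneg_left
          (inv_pow_mul_pow_le_rpow hθ hθ1.le hK) (by positivity)) hA0

/-- A SUB-LINEAR WINDOW: `W(K) = o(K)` as `K → ∞` (Mathlib's `Asymptotics.IsLittleO` along `atTop` on `ℕ`, real
casts). [folklore] (a definition) -/
def SublinearWindow (W : ℕ → ℕ) : Prop :=
  (fun K : ℕ => (W K : ℝ)) =o[atTop] fun K : ℕ => (K : ℝ)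

/-- A sub-linear window is eventually `≤ ηK` for every `η > 0`. [folklore] -/
theorem SublinearWindow.eventually_le {W : ℕ → ℕ} (hW : SublinearWindow W) {η : ℝ} (hη : 0 < η) :
    ∀ᶠ K in atTop, (W K : ℝ) ≤ η * K := by
  refine (hW.def hη).mono fun K hK => ?_
  rwa [Real.norm_of_nonneg (Nat.cast_nonneg _), Real.norm_of_nonneg (Nat.cast_nonneg _)] at hK

/-- **THE YOUNG REMNANT RATE IS SUMMABLE FOR EVERY SUB-LINEAR ALLOWANCE AND EVERY `θ < 1`** (no condition linking `θ`,
`Λ`, `C`, `W`): `summable_invPow_mul_windowSum_of_eventually` at `η = 1/2`. [folklore] -/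
theorem summable_remnantYoungW {θ Λ C : ℝ} {W : ℕ → ℕ} (hθ : 0 < θ) (hθ1 : θ < 1) (hΛ : 1 ≤ Λ) (hC : 0 ≤ C)
    (hW : SublinearWindow W) : Summable (fun K => remnantYoungW θ Λ C W K) :=
  summable_invPow_mul_windowSum_of_eventually hθ hθ1 hΛ hC one_half_lt_one (hW.eventually_le one_half_pos)

/-- The recent-remainder rate WITH the young remnant part (abstract sub-linear allowance) is summable. [folklore] -/
theorem summable_add_remnantYoungW {θ Λ C Cy : ℝ} {W : ℕ → ℕ} {r' : ℕ → ℝ} (hr : Summable r') (hθ : 0 < θ)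
    (hθ1 : θ < 1) (hΛ : 1 ≤ Λ) (hC : 0 ≤ C) (hW : SublinearWindow W) :
    Summable fun K => r' K + Cy * remnantYoungW θ Λ C W K :=
  hr.add ((summable_remnantYoungW hθ hθ1 hΛ hC hW).mul_left Cy)

end YoungW

/-! ## §6 Polylogarithmic allowances are sub-linear (the record's `A(K)·N′_K(A(K))`, v1's `N′·A(K)`, …) -/

section Polylog

open Asymptotics

/-- A POLYLOGARITHMIC WINDOW of exponent `q`: `W(K) = O((log(K+2))^q)` (`log(K+2) ≥ log 2 > 0` for every `K`, so
constants are exponent `0`). [folklore] (a definition) -/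
def PolylogWindow (W : ℕ → ℕ) (q : ℕ) : Prop :=
  (fun K : ℕ => (W K : ℝ)) =O[atTop] fun K : ℕ => Real.log ((K : ℝ) + 2) ^ q

/-- `(log(K+2))^q = o(K)` on `ℕ` (Mathlib `Real.isLittleO_pow_log_id_atTop` composed with `K ↦ K+2`, and
`K + 2 = O(K)`). [folklore] -/
theorem isLittleO_log_add_two_pow (q : ℕ) :
    (fun K : ℕ => Real.log ((K : ℝ) + 2) ^ q) =o[atTop] fun K : ℕ => (K : ℝ) := by
  have h1 : (fun x : ℝ => Real.log x ^ q) =o[atTop] (fun x : ℝ => x) := Real.isLittleO_pow_log_id_atTop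
  have ht : Tendsto (fun K : ℕ => (K : ℝ) + 2) atTop atTop :=
    tendsto_atTop_add_const_right atTop 2 tendsto_natCast_atTop_atTop
  have h2 : (fun K : ℕ => Real.log ((K : ℝ) + 2) ^ q) =o[atTop] (fun K : ℕ => (K : ℝ) + 2) :=
    h1.comp_tendsto ht
  have h3 : (fun K : ℕ => (K : ℝ) + 2) =O[atTop] (fun K : ℕ => (K : ℝ)) := by
    refine IsBigO.of_bound 2 ?_
    filter_upwards [eventually_ge_atTop 2] with K hK
    have hK' : (2 : ℝ) ≤ (K : ℝ) := by exact_mod_cast hK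
    rw [Real.norm_of_nonneg (by positivity), Real.norm_of_nonneg (Nat.cast_nonneg _)]
    linarith
  exact h2.trans_isBigO h3

/-- **EVERY POLYLOGARITHMIC ALLOWANCE IS SUB-LINEAR.** [folklore] -/
theorem PolylogWindow.sublinear {W : ℕ → ℕ} {q : ℕ} (h : PolylogWindow W q) : SublinearWindow W :=
  h.trans_isLittleO (isLittleO_log_add_two_pow q)

/-- The polylog class is CLOSED UNDER PRODUCTS, exponents adding (the record's `W(K) = A(K)·N′_K(A(K))`). [folklore] -/
theorem PolylogWindow.mul {W₁ W₂ : ℕ → ℕ} {q₁ q₂ : ℕ} (h₁ : PolylogWindow W₁ q₁) (h₂ : PolylogWindow W₂ q₂) :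
    PolylogWindow (fun K => W₁ K * W₂ K) (q₁ + q₂) :=
  (IsBigO.mul h₁ h₂).congr (fun K => by push_cast; ring) (fun K => by ring)

/-- ENTRY LEMMA in the record's (Y3) form: a pointwise bound `W K ≤ w₀ + w₁·(log(K+2))^q` puts `W` in the polylog class
of exponent `q` (constant `|w₀|/(log 2)^q + |w₁|`). [folklore] -/
theorem polylogWindow_of_le {W : ℕ → ℕ} {w₀ w₁ : ℝ} {q : ℕ}
    (h : ∀ K, (W K : ℝ) ≤ w₀ + w₁ * Real.log ((K : ℝ) + 2) ^ q) : PolylogWindow W q := by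
  refine IsBigO.of_bound (|w₀| / Real.log 2 ^ q + |w₁|) (Filter.Eventually.of_forall fun K => ?_)
  have hl2 : 0 < Real.log 2 := Real.log_pos one_lt_two
  have hK0 : (0 : ℝ) ≤ (K : ℝ) := Nat.cast_nonneg K
  have hℓ : Real.log 2 ≤ Real.log ((K : ℝ) + 2) := Real.log_le_log two_pos (by linarith)
  have hℓ0 : 0 < Real.log ((K : ℝ) + 2) := lt_of_lt_of_le hl2 hℓ
  have hp0 : 0 < Real.log 2 ^ q := pow_pos hl2 q
  have hpow : Real.log 2 ^ q ≤ Real.log ((K : ℝ) + 2) ^ q := pow_le_pow_left₀ hl2.le hℓ q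
  have h1 : (1 : ℝ) ≤ Real.log ((K : ℝ) + 2) ^ q / Real.log 2 ^ q := (one_le_div hp0).2 hpow
  rw [Real.norm_of_nonneg (Nat.cast_nonneg _), Real.norm_of_nonneg (pow_nonneg hℓ0.le _)]
  calc (W K : ℝ) ≤ w₀ + w₁ * Real.log ((K : ℝ) + 2) ^ q := h K
    _ ≤ |w₀| + |w₁| * Real.log ((K : ℝ) + 2) ^ q :=
        add_le_add (le_abs_self w₀) (mul_le_mul_of_nonneg_right (le_abs_self w₁) (pow_nonneg hℓ0.le q))
    _ ≤ |w₀| * (Real.log ((K : ℝ) + 2) ^ q / Real.log 2 ^ q) + |w₁| * Real.log ((K : ℝ) + 2) ^ q :=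
        add_le_add (le_mul_of_one_le_right (abs_nonneg w₀) h1) le_rfl
    _ = (|w₀| / Real.log 2 ^ q + |w₁|) * Real.log ((K : ℝ) + 2) ^ q := by ring

/-- The age cut `A(K) = ⌈C′·log(K+1)⌉` is polylog of exponent `1` (`C′ ≥ 0`). [folklore] -/
theorem polylogWindow_ageCut {C' : ℝ} (hC' : 0 ≤ C') : PolylogWindow (ageCut C') 1 := by
  refine polylogWindow_of_le (w₀ := 1) (w₁ := C') fun K => ?_
  have hK0 : (0 : ℝ) ≤ (K : ℝ) := Nat.cast_nonneg K
  have hK1 : (1 : ℝ) ≤ (K : ℝ) + 1 := by linarith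
  have hx : 0 ≤ C' * Real.log ((K : ℝ) + 1) := mul_nonneg hC' (Real.log_nonneg hK1)
  have h1 : ((ageCut C' K : ℕ) : ℝ) ≤ C' * Real.log ((K : ℝ) + 1) + 1 := (Nat.ceil_lt_add_one hx).le
  have h2 : Real.log ((K : ℝ) + 1) ≤ Real.log ((K : ℝ) + 2) := Real.log_le_log (by positivity) (by linarith)
  have h3 := mul_le_mul_of_nonneg_left h2 hC'
  rw [pow_one]
  linarith

/-- A constant allowance is polylog of exponent `0`. [folklore] -/
theorem polylogWindow_const (N : ℕ) : PolylogWindow (fun _ => N) 0 :=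
  polylogWindow_of_le (w₀ := N) (w₁ := 0) fun K => by simp

/-- A `K`-dependent epoch length of the record's type, `N′_K = ⌈a·(log(K+2))^p + b⌉` (`a, b ≥ 0`), is polylog of
exponent `p`. [folklore] -/
theorem polylogWindow_ceil {a b : ℝ} {p : ℕ} (ha : 0 ≤ a) (hb : 0 ≤ b) :
    PolylogWindow (fun K => ⌈a * Real.log ((K : ℝ) + 2) ^ p + b⌉₊) p := by
  refine polylogWindow_of_le (w₀ := b + 1) (w₁ := a) fun K => ?_
  have hK0 : (0 : ℝ) ≤ (K : ℝ) := Nat.cast_nonneg K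
  have hℓ0 : 0 ≤ Real.log ((K : ℝ) + 2) := Real.log_nonneg (by linarith)
  have hx : 0 ≤ a * Real.log ((K : ℝ) + 2) ^ p + b := add_nonneg (mul_nonneg ha (pow_nonneg hℓ0 _)) hb
  have h1 : ((⌈a * Real.log ((K : ℝ) + 2) ^ p + b⌉₊ : ℕ) : ℝ) ≤ a * Real.log ((K : ℝ) + 2) ^ p + b + 1 :=
    (Nat.ceil_lt_add_one hx).le
  linarith

/-- v1's window `N′·A(K)` is polylog of exponent `1`, hence sub-linear. [folklore] -/
theorem polylogWindow_mul_ageCut (N' : ℕ) {C' : ℝ} (hC' : 0 ≤ C') :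
    PolylogWindow (fun K => N' * ageCut C' K) 1 := by
  simpa using (polylogWindow_const N').mul (polylogWindow_ageCut hC')

/-- The record's window `A(K)·N′_K` with `N′_K = ⌈a·(log(K+2))^p + b⌉` is polylog of exponent `1 + p`, hence
sub-linear. [folklore] -/
theorem polylogWindow_ageCut_mul_ceil {C' a b : ℝ} {p : ℕ} (hC' : 0 ≤ C') (ha : 0 ≤ a) (hb : 0 ≤ b) :
    PolylogWindow (fun K => ageCut C' K * ⌈a * Real.log ((K : ℝ) + 2) ^ p + b⌉₊) (1 + p) :=
  (polylogWindow_ageCut hC').mul (polylogWindow_ceil ha hb)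

/-- … so v1's young lemma (`T4RemnantBooking.summable_remnantYoung_logWindow`) is RE-DERIVED by the sub-linear route
(consistency check of the generalisation). [folklore] -/
theorem summable_remnantYoung_of_sublinear {θ Λ C C' : ℝ} (N' : ℕ) (hθ : 0 < θ) (hθ1 : θ < 1) (hΛ : 1 ≤ Λ)
    (hC : 0 ≤ C) (hC' : 0 ≤ C') : Summable (fun K => remnantYoung θ Λ C C' N' K) :=
  summable_remnantYoungW hθ hθ1 hΛ hC (polylogWindow_mul_ageCut N' hC').sublinear

/-- … and the record's young budget, `θ^{−A(K)·N′_K}·windowSum`, `N′_K = ⌈a·(log(K+2))^p + b⌉`, is summable for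
every `0 < θ < 1`. [folklore] -/
theorem summable_remnantYoungW_ageCut_mul_ceil {θ Λ C C' a b : ℝ} {p : ℕ} (hθ : 0 < θ) (hθ1 : θ < 1) (hΛ : 1 ≤ Λ)
    (hC : 0 ≤ C) (hC' : 0 ≤ C') (ha : 0 ≤ a) (hb : 0 ≤ b) :
    Summable (fun K => remnantYoungW θ Λ C (fun K => ageCut C' K * ⌈a * Real.log ((K : ℝ) + 2) ^ p + b⌉₊) K) :=
  summable_remnantYoungW hθ hθ1 hΛ hC (polylogWindow_ageCut_mul_ceil hC' ha hb).sublinear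

end Polylog

/-! ## §7 The closure with the young allowance ABSTRACT (any sub-linear window) — v1.2 -/

section ClosureW

variable {ι : Type*} [DecidableEq ι] {l₀ vol : ℝ} {T : ℕ → Finset ι} {A B Acore Bcore : ℕ → ℝ → ι → ℝ}
  {Bad : ℕ → ℝ → Finset ι} {Cc Rr CcRec RrRec : ℕ → ℝ → ι → ℝ} {ν u' s₂ c₀ r' s L : ℕ → ℝ}
  {remOld : ℕ → ℕ → ℝ} {Λ C' E₀ ρ θ Cy : ℝ} {W : ℕ → ℕ}

/-- **THE NODE-U5 CLOSURE WITH NE7b-rem NAMED, YOUNG ALLOWANCE ABSTRACT** (= `hybridNE7_closure_remnant` with the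
recent-remainder rate `r := r′ + C_y·remnantYoungW θ Λ C W` for an ARBITRARY allowance `W : ℕ → ℕ` and the one binder
`hW : SublinearWindow W` (`W(K) = o(K)`) in place of v1's fixed `N′`; the old-born half — `hRem`, `1 ≤ Λ`, `0 ≤ E₀`,
`0 < ρ < 1`, `⌈C log Λ⌉₊ + 3 ≤ C′(−log ρ)` — is unchanged, and `0 ≤ C′` is no longer a binder since only the old half
mentions `C′`).  Covers the record's bank-age convention (`W = A(K)·N′_K`, §6) and v1 (`W = N′·A(K)`).  CONDITIONAL
exactly as `hybridNE7_closure_remnant`; nothing PRINTED is asserted. [folklore] -/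
theorem hybridNE7_closure_remnantW {r₀ V C : ℝ} (h0 : 0 < r₀) (h1 : r₀ < 1) (hV : 0 ≤ V) (hC : 1 < C * (-Real.log r₀))
    (hA : ∀ K t, |t| ≤ l₀ → ∀ τ ∈ T K, 0 ≤ A K t τ) (hB : ∀ K t, |t| ≤ l₀ → ∀ τ ∈ T K, 0 ≤ B K t τ)
    (hDA : SlotDom l₀ T A Bad fun K => V * r₀ ^ (K - jlogOf C K))
    (hDB : SlotDom l₀ T B Bad fun K => V * r₀ ^ (K - jlogOf C K))
    (hL0 : ∀ K, 0 ≤ L K) (hLs : Summable L)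
    (hA0 : ∀ K t, |t| ≤ l₀ → ∀ τ ∈ T K, 0 ≤ Acore K t τ)
    (hAlo : ∀ K t, |t| ≤ l₀ → ∀ τ ∈ T K, Acore K t τ ≤ A K t τ)
    (hAhi : ∀ K t, |t| ≤ l₀ → ∀ τ ∈ T K, A K t τ ≤ Real.exp (L K) * Acore K t τ)
    (hB0 : ∀ K t, |t| ≤ l₀ → ∀ τ ∈ T K, 0 ≤ Bcore K t τ)
    (hBlo : ∀ K t, |t| ≤ l₀ → ∀ τ ∈ T K, Bcore K t τ ≤ B K t τ)
    (hBhi : ∀ K t, |t| ≤ l₀ → ∀ τ ∈ T K, B K t τ ≤ Real.exp (L K) * Bcore K t τ)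
    (hRem : RemnantAgeBound remOld E₀ ρ) (hΛ : 1 ≤ Λ) (hE : 0 ≤ E₀) (hρ0 : 0 < ρ) (hρ1 : ρ < 1)
    (hq : ((⌈C * Real.log Λ⌉₊ : ℕ) : ℝ) + 3 ≤ C' * (-Real.log ρ)) (hθ : 0 < θ) (hθ1 : θ < 1) (hW : SublinearWindow W)
    (hTB : ReindexedBudget l₀ vol T Acore Bcore Bad Cc Rr CcRec RrRec ν (fun K => u' K + remnantOld remOld Λ C C' K) s₂
      c₀ (fun K => r' K + Cy * remnantYoungW θ Λ C W K) s)
    (hr : Summable r') (hu : Summable u') (hs : Summable s) (hs₂ : Summable s₂) :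
    ∃ K₀, HybridNE7 l₀ vol (fun K => T (K₀ + K)) (fun K => A (K₀ + K)) (fun K => B (K₀ + K)) (fun K => Bad (K₀ + K))
      (fun K => 1 - Real.exp (-(V * r₀ ^ (K₀ + K - jlogOf C (K₀ + K)))))
      (fun K t τ => A (K₀ + K) t τ - Acore (K₀ + K) t τ) (fun K t τ => B (K₀ + K) t τ - Bcore (K₀ + K) t τ)
      (fun K => 1 - Real.exp (-L (K₀ + K)))
      (fun K => ((r' (K₀ + K) + Cy * remnantYoungW θ Λ C W (K₀ + K)) +
          (u' (K₀ + K) + remnantOld remOld Λ C C' (K₀ + K))) + (s (K₀ + K) + s₂ (K₀ + K))) :=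
  have hC0 : 0 ≤ C := logCutConst_nonneg h0 h1 hC
  hybridNE7_closure_tail h0 h1 hV hC hA hB hDA hDB hL0 hLs hA0 hAlo hAhi hB0 hBlo hBhi hTB
    (summable_add_remnantYoungW hr hθ hθ1 hΛ hC0 hW) (summable_add_remnantOld hu hΛ hC0 hE hρ0 hρ1 hRem hq) hs hs₂

end ClosureW

/-! ## §7b Per string, end to end, young allowance abstract — v1.2 -/

section SchemeW

open Missing T4Continuum T4Assembly

variable {G : Type*} [GaugeGroup G] [MeasurableSpace G] [HaarData G] {O : Type*}

/-- **PER STRING, END TO END, NE7b-rem NAMED, YOUNG ALLOWANCE ABSTRACT** (= `stringHybridNE7_closure_remnant` with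
`r := r′ + C_y·remnantYoungW θ Λ C W`, `hW : SublinearWindow W` in place of the fixed `N′`, and without `0 ≤ C′`).
USER-FACING BINDER LIST OF NODE U5, v1.2: as in `stringHybridNE7_closure_remnant` except that the young remnant clause
reads `0 < θ < 1`, `SublinearWindow W` (ANY sub-linear allowance; polylog ones by `PolylogWindow.sublinear`).  Nothing
else. [folklore] -/
theorem stringHybridNE7_closure_remnantW (S : TorusScheme G O) (os : List O) (K₀ : ℕ) {ι : Type} [DecidableEq ι]
    {l₀ vol : ℝ} {T : ℕ → Finset ι} {A B Acore Bcore : ℕ → ℝ → ι → ℝ} {Bad : ℕ → ℝ → Finset ι}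
    {Cc Rr CcRec RrRec : ℕ → ℝ → ι → ℝ} {ν u' s₂ c₀ r' s L : ℕ → ℝ} {remOld : ℕ → ℕ → ℝ} {Λ C' E₀ ρ θ Cy : ℝ}
    {W : ℕ → ℕ} {r₀ V C : ℝ}
    (h0 : 0 < r₀) (h1 : r₀ < 1) (hV : 0 ≤ V) (hC : 1 < C * (-Real.log r₀))
    (hA : ∀ K t, |t| ≤ l₀ → ∀ τ ∈ T K, 0 ≤ A K t τ) (hB : ∀ K t, |t| ≤ l₀ → ∀ τ ∈ T K, 0 ≤ B K t τ)
    (hDA : SlotDom l₀ T A Bad fun K => V * r₀ ^ (K - jlogOf C K))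
    (hDB : SlotDom l₀ T B Bad fun K => V * r₀ ^ (K - jlogOf C K))
    (hL0 : ∀ K, 0 ≤ L K) (hLs : Summable L)
    (hA0 : ∀ K t, |t| ≤ l₀ → ∀ τ ∈ T K, 0 ≤ Acore K t τ)
    (hAlo : ∀ K t, |t| ≤ l₀ → ∀ τ ∈ T K, Acore K t τ ≤ A K t τ)
    (hAhi : ∀ K t, |t| ≤ l₀ → ∀ τ ∈ T K, A K t τ ≤ Real.exp (L K) * Acore K t τ)
    (hB0 : ∀ K t, |t| ≤ l₀ → ∀ τ ∈ T K, 0 ≤ Bcore K t τ)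
    (hBlo : ∀ K t, |t| ≤ l₀ → ∀ τ ∈ T K, Bcore K t τ ≤ B K t τ)
    (hBhi : ∀ K t, |t| ≤ l₀ → ∀ τ ∈ T K, B K t τ ≤ Real.exp (L K) * Bcore K t τ)
    (hRem : RemnantAgeBound remOld E₀ ρ) (hΛ : 1 ≤ Λ) (hE : 0 ≤ E₀) (hρ0 : 0 < ρ) (hρ1 : ρ < 1)
    (hq : ((⌈C * Real.log Λ⌉₊ : ℕ) : ℝ) + 3 ≤ C' * (-Real.log ρ)) (hθ : 0 < θ) (hθ1 : θ < 1) (hW : SublinearWindow W)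
    (hTB : ReindexedBudget l₀ vol T Acore Bcore Bad Cc Rr CcRec RrRec ν (fun K => u' K + remnantOld remOld Λ C C' K) s₂
      c₀ (fun K => r' K + Cy * remnantYoungW θ Λ C W K) s)
    (hr : Summable r') (hu : Summable u') (hs : Summable s) (hs₂ : Summable s₂)
    (hZA : ∀ K t, |t| ≤ l₀ → T4GenFunBounds.schemeZ S os (K₀ + K) t = ∑ τ ∈ T K, A K t τ)
    (hZB : ∀ K t, |t| ≤ l₀ → T4GenFunBounds.schemeZ S os (K₀ + K + 1) t = ∑ τ ∈ T K, B K t τ) :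
    ∃ K₁, StringHybridNE7 S os l₀ vol (K₀ + K₁) :=
  have hC0 : 0 ≤ C := logCutConst_nonneg h0 h1 hC
  stringHybridNE7_closure S os K₀ h0 h1 hV hC hA hB hDA hDB hL0 hLs hA0 hAlo hAhi hB0 hBlo hBhi hTB
    (summable_add_remnantYoungW hr hθ hθ1 hΛ hC0 hW) (summable_add_remnantOld hu hΛ hC0 hE hρ0 hρ1 hRem hq) hs hs₂
    hZA hZB

end SchemeW

/-! ## §8 Sanity (v1.2): the v1.2 remnant binders are jointly satisfiable, with the record's window -/

section SanityW

/-- SANITY (non-vacuity of the v1.2 binders): for any `0 ≤ E₀`, `0 < ρ < 1`, `C`, `Λ` and any epoch-length profile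
`N′_K = ⌈a·(log(K+2))^p + b⌉` (`a, b ≥ 0`) there is an age-cut constant `C′ ≥ 0` with `hRem` (saturating profile),
`hq`, AND `SublinearWindow (K ↦ A(K)·N′_K)` — the hypotheses `hRem`, `hq`, `hW` of `hybridNE7_closure_remnantW` hold
together. [folklore] -/
theorem remnantBindersW_satisfiable {E₀ ρ a b : ℝ} {p : ℕ} (hE : 0 ≤ E₀) (hρ0 : 0 < ρ) (hρ1 : ρ < 1) (ha : 0 ≤ a)
    (hb : 0 ≤ b) (C Λ : ℝ) :
    ∃ C' : ℝ, 0 ≤ C' ∧ RemnantAgeBound (fun _ A => E₀ * ρ ^ A) E₀ ρ ∧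
      ((⌈C * Real.log Λ⌉₊ : ℕ) : ℝ) + 3 ≤ C' * (-Real.log ρ) ∧
      SublinearWindow (fun K => ageCut C' K * ⌈a * Real.log ((K : ℝ) + 2) ^ p + b⌉₊) := by
  obtain ⟨C', hC', hq⟩ := exists_ageCutConst hρ0 hρ1 C Λ
  exact ⟨C', hC', remnantAgeBound_saturated hE hρ0.le, hq, (polylogWindow_ageCut_mul_ceil hC' ha hb).sublinear⟩

/-- SANITY: v1's fixed-`N′` window is an admissible `W` of v1.2. [folklore] -/
example (N' : ℕ) {C' : ℝ} (hC' : 0 ≤ C') : SublinearWindow (fun K => N' * ageCut C' K) :=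
  (polylogWindow_mul_ageCut N' hC').sublinear

end SanityW

end Literature.MathematicalPhysics.QuantumFieldTheory.Balaban1983to89.T4MatchingClosureRem
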